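import Mathlib
import HarnessLib
import Summits.ValiantsHypothesis.ValiantsHypothesis.Theorems.LacunarySymmetroidMatrixDescartesProductPlusOneCrossingSign
import Summits.ValiantsHypothesis.ValiantsHypothesis.Theorems.LacunarySymmetroidMatrixDescartesProductPlusOneCrossingBudgetLocal
import Summits.ValiantsHypothesis.ValiantsHypothesis.Theorems.LacunarySymmetroidMatrixDescartesProductPlusOneLetterSumsK

/-!
# ValiantsHypothesis / LacunarySymmetroid — crux `MatrixDescartes` (stmt-ValiantsHypothesis-18050, V1),
# LINE (A) «product_plus_one», floor (every coupling): val-idea-25 g3's AB6 LETTER-VARIANCE IDENTITY in kernel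

val-idea-25 g3's located text AB6 (HOME/STATUS 2026-08-29 00:26:16Z, memo §12 rev 7; co-read crit-6 g2 #45, crit-1 g4 #150), every format
`(m, K)`, support `d : Fin K → ℕ`, coefficient table `a : Fin m → Fin K → ℝ`, rows `f_j = Σ_l C a_{jl} X^{d_l}`, product `P = ∏ f_j`,
`θ = X·d/dX`, `φ_j = θf_j/f_j`, log-Wronskian `W(g) = g·θ(θg) − (θg)²` (✓ `…CrossingSign`), letter-partial sums `A_l(x) = Σ_j a_{jl}/f_j(x)`
(✓ `…LetterSumsK` currency; the weight `x^{d_l}` is written explicitly).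

* `theta_theta_fewnomial`, `eval_fewnomial`, `eval_theta_fewnomial`, `eval_theta_theta_fewnomial` — bookkeeping;
* ★ `letterVariance_identity` (AB6, sign-free, coupling-free, level-free, every K): off the poles, for EVERY centre `c`,
  `Σ_j W(f_j)(x)/f_j(x)² = Σ_l (d_l − c)²·x^{d_l}·A_l(x) − Σ_j (φ_j(x) − c)²`
  (`= m·[Var_A(d) − Var_j(φ)]` in the memo's words; the recentring is free because `Σ_l x^{d_l}A_l = m` and `Σ_l d_l x^{d_l}A_l = Σ_j φ_j`);
* `wronskian_sum_div_sq_neg_of_letterMoment_neg` — AB6-1 pointwise: `θF(x) < 0` wherever some centred second letter moment is `< 0`;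
* ★ `euler_deriv_mul_prod_eq_letterMoments_at_root` — at a zero `z` of `E = X·P′ − C ν·P` off `Z(P)` (any level `ν`, any centre `c`):
  `z·E′(z)·P(z) = (Σ_l (d_l − c)²·z^{d_l}·A_l(z) − Σ_j (φ_j(z) − c)²)·P(z)²` (✓ `crossing_sign` + the identity);
* ★ `eulerNumerator_deriv_mul_prod_eq_reducedMoment_at_root` — the line's `eulerNumerator d a l₀` shape: at a zero the first moment
  `Σ_l e_l z^{d_l}A_l(z)` vanishes (`e_l = d_l − d_{l₀}`), so for EVERY `κ`
  `z·R′(z)·P(z) = (Σ_l e_l(e_l − κ)·z^{d_l}·A_l(z) − Σ_j (φ_j(z) − d_{l₀})²)·P(z)²`;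
* `eulerNumerator_deriv_mul_prod_neg_of_reducedMoment_neg` — AB6-1: a zero `z > 0` at which some reduced moment is `< 0` is a STRICT
  DOWN-CROSSING (`R′(z)·P(z) < 0`): «up-crossings live in `{M₂ > 0}`»;
* ★★ `eulerNumerator_roots_Icc_le_one_of_reducedMoment_neg` — on a pole-free `[u,v] ⊂ (0,∞)` on which every zero of `R` has a negative
  reduced moment, `R` has AT MOST ONE zero (✓ `euler_roots_Icc_le_one_of_down`).  The eight type-β window counts of ✓ `…ABWindow`,
  `…ABWindowMiddle`, `…ABWindowTop`, `…ABWindowK` follow from it WITHOUT the row-sign hypotheses `hus` / `hnd` / `hls` (companion file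
  `…ABWindowSignfree`).

HONEST FRAMING: calculus identities + one located counting lemma; NOT `OneChangeFloorK3`, not `stub_classRowK3`, not `stub_eulerBoundK3`,
not `stub_polyLaw`, not `MatrixDescartes`, not Conjecture B; `VP ≠ VNP` is NOT proved.  No definitions, no named facts; Mathlib + the three
✓ files imported.
-/

set_option linter.dupNamespace false

namespace Summit.ValiantsHypothesis.ValiantsHypothesis.Theorems.LacunarySymmetroidMatrixDescartes

namespace ProductPlusOne

open Polynomial Finset
open scoped BigOperators Topology

/-! ### §0 Bookkeeping: `θ²` of a fewnomial and the three evaluations -/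

/-- `θ(θ(Σ_l C b_l X^{d_l})) = Σ_l C(b_l d_l d_l) X^{d_l}`. [folklore] -/
theorem theta_theta_fewnomial {K : ℕ} (d : Fin K → ℕ) (b : Fin K → ℝ) :
    X * derivative (X * derivative (∑ l, C (b l) * X ^ (d l) : ℝ[X])) = ∑ l, C (b l * (d l : ℝ) * (d l : ℝ)) * X ^ (d l) := by
  rw [theta_fewnomial, theta_fewnomial]

/-- `(Σ_l C b_l X^{d_l})(x) = Σ_l b_l x^{d_l}`. [folklore] -/
theorem eval_fewnomial {K : ℕ} (d : Fin K → ℕ) (b : Fin K → ℝ) (x : ℝ) :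
    (∑ l, C (b l) * X ^ (d l) : ℝ[X]).eval x = ∑ l, b l * x ^ (d l) := by
  simp only [eval_finsetSum, eval_mul, eval_C, eval_pow, eval_X]

/-- `(θ Σ_l C b_l X^{d_l})(x) = Σ_l b_l d_l x^{d_l}`. [folklore] -/
theorem eval_theta_fewnomial {K : ℕ} (d : Fin K → ℕ) (b : Fin K → ℝ) (x : ℝ) :
    (X * derivative (∑ l, C (b l) * X ^ (d l) : ℝ[X])).eval x = ∑ l, b l * (d l : ℝ) * x ^ (d l) := by
  rw [theta_fewnomial]
  simp only [eval_finsetSum, eval_mul, eval_C, eval_pow, eval_X]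

/-- `(θθ Σ_l C b_l X^{d_l})(x) = Σ_l b_l d_l² x^{d_l}`. [folklore] -/
theorem eval_theta_theta_fewnomial {K : ℕ} (d : Fin K → ℕ) (b : Fin K → ℝ) (x : ℝ) :
    (X * derivative (X * derivative (∑ l, C (b l) * X ^ (d l) : ℝ[X]))).eval x = ∑ l, b l * (d l : ℝ) * (d l : ℝ) * x ^ (d l) := by
  rw [theta_theta_fewnomial]
  simp only [eval_finsetSum, eval_mul, eval_C, eval_pow, eval_X]

/-! ### §1 AB6 — the letter-variance identity -/

/-- One row, centre `c`: `Σ_l (d_l − c)²·x^{d_l}·b_l = (θθg)(x) − 2c·(θg)(x) + c²·g(x)` for `g = Σ_l C b_l X^{d_l}`. [folklore] -/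
theorem letterMoment_two_row {K : ℕ} (d : Fin K → ℕ) (b : Fin K → ℝ) (c x : ℝ) :
    ∑ l, ((d l : ℝ) - c) ^ 2 * x ^ (d l) * b l
      = (X * derivative (X * derivative (∑ l, C (b l) * X ^ (d l) : ℝ[X]))).eval x
        - 2 * c * (X * derivative (∑ l, C (b l) * X ^ (d l) : ℝ[X])).eval x
        + c ^ 2 * (∑ l, C (b l) * X ^ (d l) : ℝ[X]).eval x := by
  rw [eval_theta_theta_fewnomial, eval_theta_fewnomial, eval_fewnomial, Finset.mul_sum, Finset.mul_sum,
    ← Finset.sum_sub_distrib, ← Finset.sum_add_distrib]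
  exact Finset.sum_congr rfl fun l _ => by ring

/-- ★ **AB6 — THE LETTER-VARIANCE IDENTITY** (val-idea-25 g3; every `K`, every centre `c`, coupling- and level-free): at a point `x` where no
row vanishes,
`Σ_j W(f_j)(x)/f_j(x)² = Σ_l (d_l − c)²·x^{d_l}·A_l(x) − Σ_j (φ_j(x) − c)²`,
`A_l(x) = Σ_j a_{jl}/f_j(x)`, `φ_j = θf_j/f_j`.  (The left side is `θF(x)`, `F = Σ_j φ_j`; with `c = F/m` the right side is
`m·[Var_A(d) − Var_j(φ)]`.) [this file's theorem; val-idea-25 AB6] -/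
theorem letterVariance_identity {m K : ℕ} (d : Fin K → ℕ) (a : Fin m → Fin K → ℝ) (c x : ℝ)
    (hf : ∀ j, (∑ l, C (a j l) * X ^ (d l) : ℝ[X]).eval x ≠ 0) :
    ∑ j, (((∑ l, C (a j l) * X ^ (d l) : ℝ[X]) * (X * derivative (X * derivative (∑ l, C (a j l) * X ^ (d l) : ℝ[X])))
            - (X * derivative (∑ l, C (a j l) * X ^ (d l) : ℝ[X])) ^ 2).eval x
          / ((∑ l, C (a j l) * X ^ (d l) : ℝ[X]).eval x) ^ 2)
      = ∑ l, ((d l : ℝ) - c) ^ 2 * x ^ (d l) * ∑ j, a j l / (∑ l', C (a j l') * X ^ (d l') : ℝ[X]).eval x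
        - ∑ j, ((X * derivative (∑ l, C (a j l) * X ^ (d l) : ℝ[X])).eval x
            / (∑ l, C (a j l) * X ^ (d l) : ℝ[X]).eval x - c) ^ 2 := by
  -- swap the double sum on the right and go row by row
  have hswap : ∑ l, ((d l : ℝ) - c) ^ 2 * x ^ (d l) * ∑ j, a j l / (∑ l', C (a j l') * X ^ (d l') : ℝ[X]).eval x
      = ∑ j, (∑ l, ((d l : ℝ) - c) ^ 2 * x ^ (d l) * a j l) / (∑ l', C (a j l') * X ^ (d l') : ℝ[X]).eval x := by
    simp only [Finset.mul_sum, Finset.sum_div]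
    rw [Finset.sum_comm]
    exact Finset.sum_congr rfl fun j _ => Finset.sum_congr rfl fun l _ => by ring
  rw [hswap, ← Finset.sum_sub_distrib]
  refine Finset.sum_congr rfl fun j _ => ?_
  rw [letterMoment_two_row d (a j) c x]
  have hfj := hf j
  simp only [eval_sub, eval_mul, eval_pow]
  field_simp
  ring

/-- **AB6-1 (pointwise form):** wherever SOME centred second letter moment `Σ_l (d_l − c)²·x^{d_l}·A_l(x)` is negative, the total
`Σ_j W(f_j)(x)/f_j(x)² = θF(x)` is negative — `F = Σ_j φ_j` is strictly decreasing (in `log x`) on `{Var_A(d) < 0}`.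
[this file's theorem; val-idea-25 AB6-1] -/
theorem wronskian_sum_div_sq_neg_of_letterMoment_neg {m K : ℕ} (d : Fin K → ℕ) (a : Fin m → Fin K → ℝ) (c x : ℝ)
    (hf : ∀ j, (∑ l, C (a j l) * X ^ (d l) : ℝ[X]).eval x ≠ 0)
    (hc : ∑ l, ((d l : ℝ) - c) ^ 2 * x ^ (d l) * ∑ j, a j l / (∑ l', C (a j l') * X ^ (d l') : ℝ[X]).eval x < 0) :
    ∑ j, (((∑ l, C (a j l) * X ^ (d l) : ℝ[X]) * (X * derivative (X * derivative (∑ l, C (a j l) * X ^ (d l) : ℝ[X])))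
            - (X * derivative (∑ l, C (a j l) * X ^ (d l) : ℝ[X])) ^ 2).eval x
          / ((∑ l, C (a j l) * X ^ (d l) : ℝ[X]).eval x) ^ 2) < 0 := by
  rw [letterVariance_identity d a c x hf]
  have hS : 0 ≤ ∑ j, ((X * derivative (∑ l, C (a j l) * X ^ (d l) : ℝ[X])).eval x
      / (∑ l, C (a j l) * X ^ (d l) : ℝ[X]).eval x - c) ^ 2 := Finset.sum_nonneg fun j _ => sq_nonneg _
  linarith

/-- **Row-wise form of the crossing sign off the poles:** `Σ_j W(f_j)(z)·∏_{i≠j} f_i(z)² = P(z)²·Σ_j W(f_j)(z)/f_j(z)²`. [folklore] -/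
theorem wronskian_sum_eq_prod_sq_mul {m : ℕ} (f : Fin m → ℝ[X]) {z : ℝ} (hf : ∀ j, (f j).eval z ≠ 0) :
    ∑ j, ((f j * (X * derivative (X * derivative (f j))) - (X * derivative (f j)) ^ 2).eval z
          * ∏ i ∈ Finset.univ.erase j, ((f i).eval z) ^ 2)
      = ((∏ j, f j).eval z) ^ 2
          * ∑ j, ((f j * (X * derivative (X * derivative (f j))) - (X * derivative (f j)) ^ 2).eval z / ((f j).eval z) ^ 2) := by
  classical
  rw [Finset.mul_sum]
  refine Finset.sum_congr rfl fun j _ => ?_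
  rw [eval_prod]
  have hmp := Finset.mul_prod_erase Finset.univ (fun i => ((f i).eval z) ^ 2) (Finset.mem_univ j)
  rw [← Finset.prod_pow, ← hmp]
  have hfj := hf j
  field_simp

/-- ★ **AB6 at a crossing** (every `K`, every level `ν`, every centre `c`): at a zero `z` of `E = X·P′ − C ν·P` where no row vanishes,
`z·E′(z)·P(z) = (Σ_l (d_l − c)²·z^{d_l}·A_l(z) − Σ_j (φ_j(z) − c)²)·P(z)²`. [this file's theorem; val-idea-25 AB6] -/
theorem euler_deriv_mul_prod_eq_letterMoments_at_root {m K : ℕ} (d : Fin K → ℕ) (a : Fin m → Fin K → ℝ) (ν c z : ℝ)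
    (hf : ∀ j, (∑ l, C (a j l) * X ^ (d l) : ℝ[X]).eval z ≠ 0)
    (hEz : (X * derivative (∏ j, ∑ l, C (a j l) * X ^ (d l)) - C ν * ∏ j, ∑ l, C (a j l) * X ^ (d l) : ℝ[X]).eval z = 0) :
    z * (derivative (X * derivative (∏ j, ∑ l, C (a j l) * X ^ (d l)) - C ν * ∏ j, ∑ l, C (a j l) * X ^ (d l) : ℝ[X])).eval z
        * (∏ j, ∑ l, C (a j l) * X ^ (d l) : ℝ[X]).eval z
      = (∑ l, ((d l : ℝ) - c) ^ 2 * z ^ (d l) * ∑ j, a j l / (∑ l', C (a j l') * X ^ (d l') : ℝ[X]).eval z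
          - ∑ j, ((X * derivative (∑ l, C (a j l) * X ^ (d l) : ℝ[X])).eval z
              / (∑ l, C (a j l) * X ^ (d l) : ℝ[X]).eval z - c) ^ 2)
        * ((∏ j, ∑ l, C (a j l) * X ^ (d l) : ℝ[X]).eval z) ^ 2 := by
  rw [crossing_sign (fun j => (∑ l, C (a j l) * X ^ (d l) : ℝ[X])) ν z hEz,
    wronskian_sum_eq_prod_sq_mul (fun j => (∑ l, C (a j l) * X ^ (d l) : ℝ[X])) hf,
    letterVariance_identity d a c z hf, mul_comm]

/-! ### §2 The line's Euler numerator: reduced moments at a zero, the sign of a crossing, the window count -/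

/-- ★ **AB6 at a zero of the line's Euler numerator** `R = eulerNumerator d a l₀` (unfolded; every format, every coupling `l₀`): the first
moment `Σ_l e_l·z^{d_l}·A_l(z)` (`e_l = d_l − d_{l₀}`) vanishes at a zero `z` off the poles (✓ `eval_eulerNumerator_eq_prod_mul_letterSumsK`),
so for EVERY `κ`:  `z·R′(z)·P(z) = (Σ_l e_l(e_l − κ)·z^{d_l}·A_l(z) − Σ_j (φ_j(z) − d_{l₀})²)·P(z)²`.
(K = 3: `κ` = the third letter's `e` leaves ONE letter; every K, bottom coupling: `κ = e_{K−1}` resp. `κ = e_1`.) [this file's theorem] -/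
theorem eulerNumerator_deriv_mul_prod_eq_reducedMoment_at_root {m K : ℕ} (d : Fin K → ℕ) (a : Fin m → Fin K → ℝ) (l₀ : Fin K)
    (κ z : ℝ) (hf : ∀ j, (∑ l, C (a j l) * X ^ (d l) : ℝ[X]).eval z ≠ 0)
    (hRz : (∑ j, (∑ l, C (a j l * ((d l : ℝ) - d l₀)) * X ^ (d l)) * ∏ i ∈ Finset.univ.erase j, (∑ l, C (a i l) * X ^ (d l))
        : ℝ[X]).eval z = 0) :
    z * (derivative (∑ j, (∑ l, C (a j l * ((d l : ℝ) - d l₀)) * X ^ (d l)) * ∏ i ∈ Finset.univ.erase j,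
            (∑ l, C (a i l) * X ^ (d l)) : ℝ[X])).eval z
        * (∏ j, ∑ l, C (a j l) * X ^ (d l) : ℝ[X]).eval z
      = (∑ l, ((d l : ℝ) - d l₀) * (((d l : ℝ) - d l₀) - κ) * z ^ (d l) * ∑ j, a j l / (∑ l', C (a j l') * X ^ (d l') : ℝ[X]).eval z
          - ∑ j, ((X * derivative (∑ l, C (a j l) * X ^ (d l) : ℝ[X])).eval z
              / (∑ l, C (a j l) * X ^ (d l) : ℝ[X]).eval z - d l₀) ^ 2)
        * ((∏ j, ∑ l, C (a j l) * X ^ (d l) : ℝ[X]).eval z) ^ 2 := by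
  classical
  have hP : (∏ j, (∑ l, C (a j l) * X ^ (d l) : ℝ[X]).eval z) ≠ 0 := Finset.prod_ne_zero_iff.2 fun j _ => hf j
  -- the first moment vanishes at a zero of `R`
  have hM1 : ∑ l, ((d l : ℝ) - d l₀) * z ^ (d l) * ∑ j, a j l / (∑ l', C (a j l') * X ^ (d l') : ℝ[X]).eval z = 0 := by
    have h := eval_eulerNumerator_eq_prod_mul_letterSumsK d a l₀ hf
    rw [hRz] at h
    exact (mul_eq_zero.mp h.symm).resolve_left hP
  have hM2 : ∑ l, ((d l : ℝ) - d l₀) * (((d l : ℝ) - d l₀) - κ) * z ^ (d l) * ∑ j, a j l / (∑ l', C (a j l') * X ^ (d l') : ℝ[X]).eval z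
      = ∑ l, ((d l : ℝ) - d l₀) ^ 2 * z ^ (d l) * ∑ j, a j l / (∑ l', C (a j l') * X ^ (d l') : ℝ[X]).eval z := by
    have h : ∑ l, ((d l : ℝ) - d l₀) * (((d l : ℝ) - d l₀) - κ) * z ^ (d l) * ∑ j, a j l / (∑ l', C (a j l') * X ^ (d l') : ℝ[X]).eval z
        = ∑ l, ((d l : ℝ) - d l₀) ^ 2 * z ^ (d l) * ∑ j, a j l / (∑ l', C (a j l') * X ^ (d l') : ℝ[X]).eval z
          - κ * ∑ l, ((d l : ℝ) - d l₀) * z ^ (d l) * ∑ j, a j l / (∑ l', C (a j l') * X ^ (d l') : ℝ[X]).eval z := by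
      rw [Finset.mul_sum, ← Finset.sum_sub_distrib]
      exact Finset.sum_congr rfl fun l _ => by ring
    rw [h, hM1, mul_zero, sub_zero]
  rw [hM2]
  have hRz' := hRz
  rw [eulerNumerator_eq_general] at hRz' ⊢
  exact euler_deriv_mul_prod_eq_letterMoments_at_root d a _ _ z hf hRz'

/-- **AB6-1 — up-crossings live in `{M₂ > 0}`:** at a zero `z > 0` of `R` off the poles at which SOME reduced second moment
`Σ_l e_l(e_l − κ)·z^{d_l}·A_l(z)` is negative, `R′(z)·P(z) < 0` — a strict down-crossing of `R/P`. [this file's theorem; val-idea-25 AB6-1] -/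
theorem eulerNumerator_deriv_mul_prod_neg_of_reducedMoment_neg {m K : ℕ} (d : Fin K → ℕ) (a : Fin m → Fin K → ℝ) (l₀ : Fin K)
    (κ : ℝ) {z : ℝ} (hz : 0 < z) (hf : ∀ j, (∑ l, C (a j l) * X ^ (d l) : ℝ[X]).eval z ≠ 0)
    (hRz : (∑ j, (∑ l, C (a j l * ((d l : ℝ) - d l₀)) * X ^ (d l)) * ∏ i ∈ Finset.univ.erase j, (∑ l, C (a i l) * X ^ (d l))
        : ℝ[X]).eval z = 0)
    (hκ : ∑ l, ((d l : ℝ) - d l₀) * (((d l : ℝ) - d l₀) - κ) * z ^ (d l) * ∑ j, a j l / (∑ l', C (a j l') * X ^ (d l') : ℝ[X]).eval z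
        < 0) :
    (derivative (∑ j, (∑ l, C (a j l * ((d l : ℝ) - d l₀)) * X ^ (d l)) * ∏ i ∈ Finset.univ.erase j,
          (∑ l, C (a i l) * X ^ (d l)) : ℝ[X])).eval z
        * (∏ j, ∑ l, C (a j l) * X ^ (d l) : ℝ[X]).eval z < 0 := by
  have h := eulerNumerator_deriv_mul_prod_eq_reducedMoment_at_root d a l₀ κ z hf hRz
  have hP : (∏ j, ∑ l, C (a j l) * X ^ (d l) : ℝ[X]).eval z ≠ 0 := by
    rw [eval_prod]; exact Finset.prod_ne_zero_iff.2 fun j _ => hf j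
  have hS : 0 ≤ ∑ j, ((X * derivative (∑ l, C (a j l) * X ^ (d l) : ℝ[X])).eval z
      / (∑ l, C (a j l) * X ^ (d l) : ℝ[X]).eval z - d l₀) ^ 2 := Finset.sum_nonneg fun j _ => sq_nonneg _
  have hM : ∑ l, ((d l : ℝ) - d l₀) * (((d l : ℝ) - d l₀) - κ) * z ^ (d l) * ∑ j, a j l / (∑ l', C (a j l') * X ^ (d l') : ℝ[X]).eval z
          - ∑ j, ((X * derivative (∑ l, C (a j l) * X ^ (d l) : ℝ[X])).eval z
              / (∑ l, C (a j l) * X ^ (d l) : ℝ[X]).eval z - d l₀) ^ 2 < 0 := by linarith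
  have hrhs := mul_neg_of_neg_of_pos hM (sq_pos_iff.mpr hP)
  rw [← h, mul_assoc] at hrhs
  exact neg_of_mul_neg_right hrhs hz.le

/-- ★★ **THE SIGN-FREE WINDOW COUNT** (every format, every coupling; no row-sign hypothesis): on a pole-free interval `[u,v] ⊂ (0,∞)` on which
EVERY zero of `R` has SOME negative reduced second moment, `R` has AT MOST ONE zero (every zero is a strict down-crossing of `R/P`;
✓ `euler_roots_Icc_le_one_of_down`). [this file's theorem; val-idea-25 AB6-2] -/
theorem eulerNumerator_roots_Icc_le_one_of_reducedMoment_neg {m K : ℕ} (d : Fin K → ℕ) (a : Fin m → Fin K → ℝ) (l₀ : Fin K)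
    {u v : ℝ} (hu : 0 < u) (hf : ∀ t ∈ Set.Icc u v, ∀ j, (∑ l, C (a j l) * X ^ (d l) : ℝ[X]).eval t ≠ 0)
    (hneg : ∀ t ∈ Set.Icc u v,
      (∑ j, (∑ l, C (a j l * ((d l : ℝ) - d l₀)) * X ^ (d l)) * ∏ i ∈ Finset.univ.erase j, (∑ l, C (a i l) * X ^ (d l))
          : ℝ[X]).eval t = 0 →
        ∃ κ : ℝ, ∑ l, ((d l : ℝ) - d l₀) * (((d l : ℝ) - d l₀) - κ) * t ^ (d l)
            * ∑ j, a j l / (∑ l', C (a j l') * X ^ (d l') : ℝ[X]).eval t < 0) :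
    ((∑ j, (∑ l, C (a j l * ((d l : ℝ) - d l₀)) * X ^ (d l)) * ∏ i ∈ Finset.univ.erase j, (∑ l, C (a i l) * X ^ (d l))
        : ℝ[X]).roots.toFinset.filter (fun t => u ≤ t ∧ t ≤ v)).card ≤ 1 := by
  have hP : ∀ t ∈ Set.Icc u v, (∏ j, (∑ l, C (a j l) * X ^ (d l) : ℝ[X])).eval t ≠ 0 := fun t ht => by
    rw [eval_prod]; exact Finset.prod_ne_zero_iff.2 fun j _ => hf t ht j
  have hdown : ∀ t ∈ Set.Icc u v,
      (X * derivative (∏ j, (∑ l, C (a j l) * X ^ (d l) : ℝ[X]))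
          - C ((m : ℝ) * (d l₀ : ℝ)) * ∏ j, (∑ l, C (a j l) * X ^ (d l) : ℝ[X])).eval t = 0 →
        (derivative (X * derivative (∏ j, (∑ l, C (a j l) * X ^ (d l) : ℝ[X]))
            - C ((m : ℝ) * (d l₀ : ℝ)) * ∏ j, (∑ l, C (a j l) * X ^ (d l) : ℝ[X]))).eval t
          * (∏ j, (∑ l, C (a j l) * X ^ (d l) : ℝ[X])).eval t < 0 := by
    intro t ht hEt
    rw [← eulerNumerator_eq_general] at hEt ⊢
    obtain ⟨κ, hκ⟩ := hneg t ht hEt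
    exact eulerNumerator_deriv_mul_prod_neg_of_reducedMoment_neg d a l₀ κ (hu.trans_le ht.1) (hf t ht) hEt hκ
  have key := euler_roots_Icc_le_one_of_down (fun j => (∑ l, C (a j l) * X ^ (d l) : ℝ[X])) ((m : ℝ) * (d l₀ : ℝ)) hP hdown
  rw [eulerNumerator_eq_general]
  exact key

end ProductPlusOne

end Summit.ValiantsHypothesis.ValiantsHypothesis.Theorems.LacunarySymmetroidMatrixDescartes
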